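/-
Width seat `ym-line-sgb-p1-w3` (gen 2, seat prover-ym-line-sgb-p1-w3-g2-0), route `SteinGapBootstrap`, crux U `FreeProbeLawG`
(stmt-QuantumFields-23756), line `birth` (lead ym-line-sgb-k1-g1) — helper A2a requested by the lead (`Lines/birth_A2a.lean`), statements verbatim.
-/
import Summits.QuantumFields.YangMills.Theorems.SteinGapBootstrapFreeProbeLawGTestFunDeriv
import HarnessLib

/-!
# Crux U `FreeProbeLawG` (stmt-QuantumFields-23756), line `birth` — assembly part A2a: the lead's eight lemmas on the weight test functions

NOT THE CLAY GAP: route `SteinGapBootstrap` serves the RECORD-label rung R2ξ-G (`WeakCouplingRates.XiPow`, an UPPER bound on the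
lattice gap); this file is pure finite-dimensional calculus and bears on no summit statement.

Setting (the lead's spec `Cruxes/FreeProbeLawG/Lines/birth_A2a.lean`, statements kept VERBATIM): on `ι → Fin D → ℝ` with the sup norm,
coefficients `c : ι → ℝ`, base index `p₀`, colour `a`, `δ > 0`; `z_b(y) = Σ_q c_q y_q^b`, `x_b(y) = y_{p₀}^b − z_b(y)`,
`W(y) = exp(−(δ/2) Σ_b (x_b² + z_b²))`, `gZ = z_a W`, `gX = x_a W`, `vec_q^b = [b = a] c_q`.
Proved: `C¹` regularity (`contDiff_gZ/gX`); the directional derivatives along `vec` in closed form (`fderiv_gZ_vec/gX_vec`); the sup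
bounds `|gZ|, |gX| ≤ δ^{-1/2}` (`abs_gZ_le/gX_le`); the operator-norm bounds `‖D gZ‖, ‖D gX‖ ≤ (D+2)(1 + Σ|c_q|)`
(`norm_fderiv_gZ_le/gX_le`; the hypothesis `δ ≤ 1` is not needed and kept only for the verbatim signature).  Derivatives and scalar
inequalities: `…FreeProbeLawGTestFunDeriv`.

References: E. Meckes, IMS Coll. 5 (2009) 153, §1 (smooth test functions for Stein's method) [Meckes2009]; S. Chatterjee,
arXiv:1602.01222 §11 [arXiv160201222].
-/

set_option autoImplicit false

noncomputable section

open Real Finset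

namespace Summit.QuantumFields.YangMills.Cruxes.FreeProbeLawG.SteinFree

namespace TestFun

variable {ι : Type*} [Fintype ι] {D : ℕ} (c : ι → ℝ) (p₀ : ι) (δ : ℝ) (a : Fin D)

/-! ### The lead's eight lemmas (statements verbatim from `Lines/birth_A2a.lean`) -/

/-- Directional derivative of `gZ` along `vec_q^b = [b = a] c_q`:
`D gZ(y)[vec] = (Σ c²)·(W − δ z_a² W) + (c_{p₀} − Σ c²)·(−δ x_a z_a W)`. -/
theorem fderiv_gZ_vec (y : ι → Fin D → ℝ) :
    fderiv ℝ (fun y : ι → Fin D → ℝ => (∑ q, c q * y q a) *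
      Real.exp (-(δ / 2) * ∑ b, ((y p₀ b - ∑ q, c q * y q b) ^ 2 + (∑ q, c q * y q b) ^ 2))) y
      (fun q b => if b = a then c q else 0) =
    (∑ q, c q ^ 2) *
        (Real.exp (-(δ / 2) * ∑ b, ((y p₀ b - ∑ q, c q * y q b) ^ 2 + (∑ q, c q * y q b) ^ 2)) -
          δ * (∑ q, c q * y q a) ^ 2 *
            Real.exp (-(δ / 2) * ∑ b, ((y p₀ b - ∑ q, c q * y q b) ^ 2 + (∑ q, c q * y q b) ^ 2))) +
      (c p₀ - ∑ q, c q ^ 2) *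
        (-δ * (y p₀ a - ∑ q, c q * y q a) * (∑ q, c q * y q a) *
          Real.exp (-(δ / 2) * ∑ b, ((y p₀ b - ∑ q, c q * y q b) ^ 2 + (∑ q, c q * y q b) ^ 2))) := by
  rw [(hasFDerivAt_gZ c p₀ δ a y).fderiv]
  simp only [_root_.add_apply, _root_.smul_apply, _root_.sum_apply, _root_.sub_apply, ContinuousLinearMap.comp_apply,
    ContinuousLinearMap.proj_apply, smul_eq_mul, sum_mul_vec]
  simp only [if_true, ite_sub_ite, sub_self, mul_ite, mul_zero, ite_add_ite, add_zero, Finset.sum_ite_eq', Finset.mem_univ,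
    ← pow_two]
  ring


/-- Directional derivative of `gX` along `vec`:
`D gX(y)[vec] = (Σ c²)·(−δ x_a z_a W) + (c_{p₀} − Σ c²)·(W − δ x_a² W)`. -/
theorem fderiv_gX_vec (y : ι → Fin D → ℝ) :
    fderiv ℝ (fun y : ι → Fin D → ℝ => (y p₀ a - ∑ q, c q * y q a) *
      Real.exp (-(δ / 2) * ∑ b, ((y p₀ b - ∑ q, c q * y q b) ^ 2 + (∑ q, c q * y q b) ^ 2))) y
      (fun q b => if b = a then c q else 0) =
    (∑ q, c q ^ 2) *
        (-δ * (y p₀ a - ∑ q, c q * y q a) * (∑ q, c q * y q a) *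
          Real.exp (-(δ / 2) * ∑ b, ((y p₀ b - ∑ q, c q * y q b) ^ 2 + (∑ q, c q * y q b) ^ 2))) +
      (c p₀ - ∑ q, c q ^ 2) *
        (Real.exp (-(δ / 2) * ∑ b, ((y p₀ b - ∑ q, c q * y q b) ^ 2 + (∑ q, c q * y q b) ^ 2)) -
          δ * (y p₀ a - ∑ q, c q * y q a) ^ 2 *
            Real.exp (-(δ / 2) * ∑ b, ((y p₀ b - ∑ q, c q * y q b) ^ 2 + (∑ q, c q * y q b) ^ 2))) := by
  rw [(hasFDerivAt_gX c p₀ δ a y).fderiv]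
  simp only [_root_.add_apply, _root_.smul_apply, _root_.sum_apply, _root_.sub_apply, ContinuousLinearMap.comp_apply,
    ContinuousLinearMap.proj_apply, smul_eq_mul, sum_mul_vec]
  simp only [if_true, ite_sub_ite, sub_self, mul_ite, mul_zero, ite_add_ite, add_zero, Finset.sum_ite_eq', Finset.mem_univ,
    ← pow_two]
  ring

/-- `gZ = z_a · W` is `C¹`. -/
theorem contDiff_gZ :
    ContDiff ℝ 1 (fun y : ι → Fin D → ℝ => (∑ q, c q * y q a) *
      Real.exp (-(δ / 2) * ∑ b, ((y p₀ b - ∑ q, c q * y q b) ^ 2 + (∑ q, c q * y q b) ^ 2))) := by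
  fun_prop

/-- `gX = x_a · W` is `C¹`. -/
theorem contDiff_gX :
    ContDiff ℝ 1 (fun y : ι → Fin D → ℝ => (y p₀ a - ∑ q, c q * y q a) *
      Real.exp (-(δ / 2) * ∑ b, ((y p₀ b - ∑ q, c q * y q b) ^ 2 + (∑ q, c q * y q b) ^ 2))) := by
  fun_prop

/-! ### The sup bounds -/

/-- `|gZ| ≤ δ^(−1/2)` (`|z| e^{−δ z²/2} ≤ (eδ)^(−1/2)`). -/
theorem abs_gZ_le (hδ : 0 < δ) (y : ι → Fin D → ℝ) :
    |(∑ q, c q * y q a) *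
      Real.exp (-(δ / 2) * ∑ b, ((y p₀ b - ∑ q, c q * y q b) ^ 2 + (∑ q, c q * y q b) ^ 2))| ≤ δ ^ (-(1 / 2 : ℝ)) := by
  have hle : -(δ / 2) * ∑ b, ((y p₀ b - ∑ q, c q * y q b) ^ 2 + (∑ q, c q * y q b) ^ 2) ≤
      -(δ / 2) * (∑ q, c q * y q a) ^ 2 := by
    have h : (∑ q, c q * y q a) ^ 2 ≤ ∑ b, ((y p₀ b - ∑ q, c q * y q b) ^ 2 + (∑ q, c q * y q b) ^ 2) :=
      le_trans (by nlinarith [sq_nonneg (y p₀ a - ∑ q, c q * y q a)])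
        (Finset.single_le_sum (f := fun b => (y p₀ b - ∑ q, c q * y q b) ^ 2 + (∑ q, c q * y q b) ^ 2)
          (fun b _ => by positivity) (Finset.mem_univ a))
    nlinarith
  rw [abs_mul, abs_of_pos (Real.exp_pos _)]
  exact (mul_le_mul_of_nonneg_left (Real.exp_le_exp.2 hle) (abs_nonneg _)).trans (abs_mul_exp_le hδ _)

/-- `|gX| ≤ δ^(−1/2)`. -/
theorem abs_gX_le (hδ : 0 < δ) (y : ι → Fin D → ℝ) :
    |(y p₀ a - ∑ q, c q * y q a) *
      Real.exp (-(δ / 2) * ∑ b, ((y p₀ b - ∑ q, c q * y q b) ^ 2 + (∑ q, c q * y q b) ^ 2))| ≤ δ ^ (-(1 / 2 : ℝ)) := by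
  have hle : -(δ / 2) * ∑ b, ((y p₀ b - ∑ q, c q * y q b) ^ 2 + (∑ q, c q * y q b) ^ 2) ≤
      -(δ / 2) * (y p₀ a - ∑ q, c q * y q a) ^ 2 := by
    have h : (y p₀ a - ∑ q, c q * y q a) ^ 2 ≤ ∑ b, ((y p₀ b - ∑ q, c q * y q b) ^ 2 + (∑ q, c q * y q b) ^ 2) :=
      le_trans (by nlinarith [sq_nonneg (∑ q, c q * y q a)])
        (Finset.single_le_sum (f := fun b => (y p₀ b - ∑ q, c q * y q b) ^ 2 + (∑ q, c q * y q b) ^ 2)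
          (fun b _ => by positivity) (Finset.mem_univ a))
    nlinarith
  rw [abs_mul, abs_of_pos (Real.exp_pos _)]
  exact (mul_le_mul_of_nonneg_left (Real.exp_le_exp.2 hle) (abs_nonneg _)).trans (abs_mul_exp_le hδ _)

/-! ### The operator-norm bounds -/

/-- Operator norm of `D gZ` (sup norm on `ι → Fin D → ℝ`): `‖D gZ(y)‖ ≤ (D + 2)(1 + Σ_q |c_q|)` for `0 < δ ≤ 1`. -/
theorem norm_fderiv_gZ_le (hδ : 0 < δ) (hδ1 : δ ≤ 1) (y : ι → Fin D → ℝ) :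
    ‖fderiv ℝ (fun y : ι → Fin D → ℝ => (∑ q, c q * y q a) *
      Real.exp (-(δ / 2) * ∑ b, ((y p₀ b - ∑ q, c q * y q b) ^ 2 + (∑ q, c q * y q b) ^ 2))) y‖ ≤
      ((D : ℝ) + 2) * (1 + ∑ q, |c q|) := by
  have _hδ1 := hδ1
  rw [(hasFDerivAt_gZ c p₀ δ a y).fderiv]
  set S : ℝ := ∑ q, |c q| with hS
  set W : ℝ := Real.exp (-(δ / 2) * ∑ b, ((y p₀ b - ∑ q, c q * y q b) ^ 2 + (∑ q, c q * y q b) ^ 2)) with hW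
  have hS0 : 0 ≤ S := Finset.sum_nonneg fun q _ => abs_nonneg _
  have hW0 : 0 < W := Real.exp_pos _
  have hW1 : W ≤ 1 := Real.exp_le_one_iff.2 (by
    have : 0 ≤ ∑ b, ((y p₀ b - ∑ q, c q * y q b) ^ 2 + (∑ q, c q * y q b) ^ 2) := Finset.sum_nonneg fun b _ => by positivity
    nlinarith)
  have hcore := weight_core_le (D := D) hδ (fun b => y p₀ b - ∑ q, c q * y q b) (fun b => ∑ q, c q * y q b) (∑ q, c q * y q a)
    (le_trans (by nlinarith [sq_nonneg (y p₀ a - ∑ q, c q * y q a)])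
      (Finset.single_le_sum (f := fun b => (y p₀ b - ∑ q, c q * y q b) ^ 2 + (∑ q, c q * y q b) ^ 2)
        (fun b _ => by positivity) (Finset.mem_univ a)))
  refine ContinuousLinearMap.opNorm_le_bound _ (by positivity) fun v => ?_
  simp only [_root_.add_apply, _root_.smul_apply, _root_.sum_apply, _root_.sub_apply, ContinuousLinearMap.comp_apply,
    ContinuousLinearMap.proj_apply, smul_eq_mul, Real.norm_eq_abs]
  -- bound the two pieces
  have hA : ∀ b, |2 * (y p₀ b - ∑ q, c q * y q b) * (v p₀ b - ∑ x, c x * v x b) + (2 * ∑ q, c q * y q b) * ∑ x, c x * v x b| ≤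
      2 * (1 + S) * ‖v‖ * (|y p₀ b - ∑ q, c q * y q b| + |∑ q, c q * y q b|) := by
    intro b
    have h1 := abs_sub_sum_mul_le c p₀ v b
    have h2 := abs_sum_mul_le c v b
    have h3 : |∑ x, c x * v x b| ≤ (1 + S) * ‖v‖ := h2.trans (by nlinarith [norm_nonneg v])
    refine (abs_add_le _ _).trans ?_
    simp only [abs_mul, abs_two]
    have hx0 := abs_nonneg (y p₀ b - ∑ q, c q * y q b)
    have hz0 := abs_nonneg (∑ q, c q * y q b)
    nlinarith [mul_le_mul_of_nonneg_left h1 hx0, mul_le_mul_of_nonneg_left h3 hz0]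
  have hsum : |∑ b, (2 * (y p₀ b - ∑ q, c q * y q b) * (v p₀ b - ∑ x, c x * v x b) +
      (2 * ∑ q, c q * y q b) * ∑ x, c x * v x b)| ≤
      2 * (1 + S) * ‖v‖ * ∑ b, (|y p₀ b - ∑ q, c q * y q b| + |∑ q, c q * y q b|) := by
    rw [Finset.mul_sum]
    exact (Finset.abs_sum_le_sum_abs _ _).trans (Finset.sum_le_sum fun b _ => hA b)
  have hlin : |∑ x, c x * v x a| ≤ S * ‖v‖ := abs_sum_mul_le c v a
  -- assemble
  have hv0 := norm_nonneg v
  have hz0 := abs_nonneg (∑ q, c q * y q a)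
  have hT1 : |(∑ q, c q * y q a) * (W * (-(δ / 2) * ∑ b, (2 * (y p₀ b - ∑ q, c q * y q b) * (v p₀ b - ∑ x, c x * v x b) +
      (2 * ∑ q, c q * y q b) * ∑ x, c x * v x b)))| ≤ ((D : ℝ) + 1 / 2) * (1 + S) * ‖v‖ := by
    rw [abs_mul, abs_mul, abs_mul, abs_of_pos hW0, show |(-(δ / 2))| = δ / 2 by rw [abs_neg, abs_of_pos (by positivity)]]
    calc |∑ q, c q * y q a| * (W * (δ / 2 * |∑ b, (2 * (y p₀ b - ∑ q, c q * y q b) * (v p₀ b - ∑ x, c x * v x b) +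
          (2 * ∑ q, c q * y q b) * ∑ x, c x * v x b)|))
        ≤ |∑ q, c q * y q a| * (W * (δ / 2 * (2 * (1 + S) * ‖v‖ *
            ∑ b, (|y p₀ b - ∑ q, c q * y q b| + |∑ q, c q * y q b|)))) := by gcongr
      _ = (δ * W * |∑ q, c q * y q a| * ∑ b, (|y p₀ b - ∑ q, c q * y q b| + |∑ q, c q * y q b|)) * ((1 + S) * ‖v‖) := by ring
      _ ≤ ((D : ℝ) + 1 / 2) * ((1 + S) * ‖v‖) := mul_le_mul_of_nonneg_right hcore (by positivity)
      _ = ((D : ℝ) + 1 / 2) * (1 + S) * ‖v‖ := by ring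
  have hT2 : |W * ∑ x, c x * v x a| ≤ S * ‖v‖ := by
    rw [abs_mul, abs_of_pos hW0]
    calc W * |∑ x, c x * v x a| ≤ 1 * (S * ‖v‖) := mul_le_mul hW1 hlin (abs_nonneg _) zero_le_one
      _ = S * ‖v‖ := one_mul _
  calc |(∑ q, c q * y q a) * (W * (-(δ / 2) * ∑ b, (2 * (y p₀ b - ∑ q, c q * y q b) * (v p₀ b - ∑ x, c x * v x b) +
        (2 * ∑ q, c q * y q b) * ∑ x, c x * v x b))) + W * ∑ x, c x * v x a|
      ≤ ((D : ℝ) + 1 / 2) * (1 + S) * ‖v‖ + S * ‖v‖ := (abs_add_le _ _).trans (add_le_add hT1 hT2)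
    _ ≤ ((D : ℝ) + 2) * (1 + S) * ‖v‖ := by nlinarith [Nat.cast_nonneg (α := ℝ) D]

/-- Operator norm of `D gX`: `‖D gX(y)‖ ≤ (D + 2)(1 + Σ_q |c_q|)` for `0 < δ ≤ 1`. -/
theorem norm_fderiv_gX_le (hδ : 0 < δ) (hδ1 : δ ≤ 1) (y : ι → Fin D → ℝ) :
    ‖fderiv ℝ (fun y : ι → Fin D → ℝ => (y p₀ a - ∑ q, c q * y q a) *
      Real.exp (-(δ / 2) * ∑ b, ((y p₀ b - ∑ q, c q * y q b) ^ 2 + (∑ q, c q * y q b) ^ 2))) y‖ ≤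
      ((D : ℝ) + 2) * (1 + ∑ q, |c q|) := by
  have _hδ1 := hδ1
  rw [(hasFDerivAt_gX c p₀ δ a y).fderiv]
  set S : ℝ := ∑ q, |c q| with hS
  set W : ℝ := Real.exp (-(δ / 2) * ∑ b, ((y p₀ b - ∑ q, c q * y q b) ^ 2 + (∑ q, c q * y q b) ^ 2)) with hW
  have hS0 : 0 ≤ S := Finset.sum_nonneg fun q _ => abs_nonneg _
  have hW0 : 0 < W := Real.exp_pos _
  have hW1 : W ≤ 1 := Real.exp_le_one_iff.2 (by
    have : 0 ≤ ∑ b, ((y p₀ b - ∑ q, c q * y q b) ^ 2 + (∑ q, c q * y q b) ^ 2) := Finset.sum_nonneg fun b _ => by positivity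
    nlinarith)
  have hcore := weight_core_le (D := D) hδ (fun b => y p₀ b - ∑ q, c q * y q b) (fun b => ∑ q, c q * y q b)
    (y p₀ a - ∑ q, c q * y q a)
    (le_trans (by nlinarith [sq_nonneg (∑ q, c q * y q a)])
      (Finset.single_le_sum (f := fun b => (y p₀ b - ∑ q, c q * y q b) ^ 2 + (∑ q, c q * y q b) ^ 2)
        (fun b _ => by positivity) (Finset.mem_univ a)))
  refine ContinuousLinearMap.opNorm_le_bound _ (by positivity) fun v => ?_
  simp only [_root_.add_apply, _root_.smul_apply, _root_.sum_apply, _root_.sub_apply, ContinuousLinearMap.comp_apply,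
    ContinuousLinearMap.proj_apply, smul_eq_mul, Real.norm_eq_abs]
  have hA : ∀ b, |2 * (y p₀ b - ∑ q, c q * y q b) * (v p₀ b - ∑ x, c x * v x b) + (2 * ∑ q, c q * y q b) * ∑ x, c x * v x b| ≤
      2 * (1 + S) * ‖v‖ * (|y p₀ b - ∑ q, c q * y q b| + |∑ q, c q * y q b|) := by
    intro b
    have h1 := abs_sub_sum_mul_le c p₀ v b
    have h2 := abs_sum_mul_le c v b
    have h3 : |∑ x, c x * v x b| ≤ (1 + S) * ‖v‖ := h2.trans (by nlinarith [norm_nonneg v])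
    refine (abs_add_le _ _).trans ?_
    simp only [abs_mul, abs_two]
    have hx0 := abs_nonneg (y p₀ b - ∑ q, c q * y q b)
    have hz0 := abs_nonneg (∑ q, c q * y q b)
    nlinarith [mul_le_mul_of_nonneg_left h1 hx0, mul_le_mul_of_nonneg_left h3 hz0]
  have hsum : |∑ b, (2 * (y p₀ b - ∑ q, c q * y q b) * (v p₀ b - ∑ x, c x * v x b) +
      (2 * ∑ q, c q * y q b) * ∑ x, c x * v x b)| ≤
      2 * (1 + S) * ‖v‖ * ∑ b, (|y p₀ b - ∑ q, c q * y q b| + |∑ q, c q * y q b|) := by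
    rw [Finset.mul_sum]
    exact (Finset.abs_sum_le_sum_abs _ _).trans (Finset.sum_le_sum fun b _ => hA b)
  have hlin : |v p₀ a - ∑ x, c x * v x a| ≤ (1 + S) * ‖v‖ := abs_sub_sum_mul_le c p₀ v a
  have hv0 := norm_nonneg v
  have hT1 : |(y p₀ a - ∑ q, c q * y q a) * (W * (-(δ / 2) * ∑ b, (2 * (y p₀ b - ∑ q, c q * y q b) * (v p₀ b - ∑ x, c x * v x b) +
      (2 * ∑ q, c q * y q b) * ∑ x, c x * v x b)))| ≤ ((D : ℝ) + 1 / 2) * (1 + S) * ‖v‖ := by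
    rw [abs_mul, abs_mul, abs_mul, abs_of_pos hW0, show |(-(δ / 2))| = δ / 2 by rw [abs_neg, abs_of_pos (by positivity)]]
    calc |y p₀ a - ∑ q, c q * y q a| * (W * (δ / 2 * |∑ b, (2 * (y p₀ b - ∑ q, c q * y q b) * (v p₀ b - ∑ x, c x * v x b) +
          (2 * ∑ q, c q * y q b) * ∑ x, c x * v x b)|))
        ≤ |y p₀ a - ∑ q, c q * y q a| * (W * (δ / 2 * (2 * (1 + S) * ‖v‖ *
            ∑ b, (|y p₀ b - ∑ q, c q * y q b| + |∑ q, c q * y q b|)))) := by gcongr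
      _ = (δ * W * |y p₀ a - ∑ q, c q * y q a| * ∑ b, (|y p₀ b - ∑ q, c q * y q b| + |∑ q, c q * y q b|)) *
            ((1 + S) * ‖v‖) := by ring
      _ ≤ ((D : ℝ) + 1 / 2) * ((1 + S) * ‖v‖) := mul_le_mul_of_nonneg_right hcore (by positivity)
      _ = ((D : ℝ) + 1 / 2) * (1 + S) * ‖v‖ := by ring
  have hT2 : |W * (v p₀ a - ∑ x, c x * v x a)| ≤ (1 + S) * ‖v‖ := by
    rw [abs_mul, abs_of_pos hW0]
    calc W * |v p₀ a - ∑ x, c x * v x a| ≤ 1 * ((1 + S) * ‖v‖) := mul_le_mul hW1 hlin (abs_nonneg _) zero_le_one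
      _ = (1 + S) * ‖v‖ := one_mul _
  calc |(y p₀ a - ∑ q, c q * y q a) * (W * (-(δ / 2) * ∑ b, (2 * (y p₀ b - ∑ q, c q * y q b) * (v p₀ b - ∑ x, c x * v x b) +
        (2 * ∑ q, c q * y q b) * ∑ x, c x * v x b))) + W * (v p₀ a - ∑ x, c x * v x a)|
      ≤ ((D : ℝ) + 1 / 2) * (1 + S) * ‖v‖ + (1 + S) * ‖v‖ := (abs_add_le _ _).trans (add_le_add hT1 hT2)
    _ ≤ ((D : ℝ) + 2) * (1 + S) * ‖v‖ := by nlinarith [Nat.cast_nonneg (α := ℝ) D]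

end TestFun

end Summit.QuantumFields.YangMills.Cruxes.FreeProbeLawG.SteinFree

end
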